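import Mathlib
import HarnessLib
import Summits.NavierStokesRegularity.NavierStokesRegularity.Theorems.UnthreadedDoorAntidynamoWallAccumulating
import Summits.NavierStokesRegularity.NavierStokesRegularity.Theorems.UnthreadedDoorCellFluxForwardVanishing

/-!
# Route `UnthreadedDoor` / `ThreadingFlux`, crux `PoloidalLiouville` (stmt-NavierStokesRegularity-1222), antidynamo v2 skeleton
# (sha16 `4ebf5683127b`), WALL `stub_scalarLiouville`: ONE-INSTANT CLOSERS — irrotational at one instant, or on one open set at one
# instant, ⇒ irrotational at all times

Support file (seat leafhand-ns-unthreadeddoor-2 g1, cell decomp-ns), `--supports stmt-NavierStokesRegularity-1222 --as helper`; theorems only.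

Backward uniqueness for Navier–Stokes is a deep theorem in general; for the wall's class it is free, because an unthreaded bounded ancient mild
solution is jointly real-analytic in its given frame unless it is irrotational (`CellFlux.unthreadedAnalyticOrIrrotational`, Σ-5a + Z, landed):

* ★★ `curl_eq_zero_of_curl_slice_eq_zero` — **IRROTATIONAL AT ONE INSTANT ⇒ IRROTATIONAL AT ALL TIMES**: if `curl v(t₁, ·) ≡ 0` for one `t₁ < 0`
  then `curl v ≡ 0` on `(−∞,0) × ℝ³` (forward by `CellFlux.forwardVanishing`; backward by the identity theorem for the analytic
  `t ↦ curl v(t, x)`, which vanishes on `[t₁, 0)`).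
* ★★ `curl_eq_zero_of_curl_eq_zero_on_open` — **AN OPEN ZERO SET OF THE VORTICITY AT ONE INSTANT ⇒ IRROTATIONAL AT ALL TIMES**: if `curl v(t₁, ·)`
  vanishes on a non-empty open set for one `t₁ < 0`, then `curl v ≡ 0` (identity theorem for the analytic slice `x ↦ curl v(t₁, x)` on the
  preconnected `ℝ³`, then the previous theorem); `constant_…`; the wall's letters `stubScalarLiouville_of_slice_eq_zero` /
  `stubScalarLiouville_of_eq_zero_on_open`.
* `dense_curl_ne_zero_or_curl_eq_zero` — hence the dichotomy used by every level-set argument on the wall: EITHER `curl v ≡ 0` on `(−∞,0) × ℝ³`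
  OR at EVERY `t < 0` the set `{x | curl v(t, x) ≠ 0}` is DENSE in `ℝ³`.

MEANING FOR THE WALL (repair census / the skeleton's CRITICAL-SET CAVEAT): for a non-trivial flow of the wall's class the critical set
`{∇T × (x − x₀) = 0} = {ω = 0}`, on which the level-set-local law (2a′) says nothing, has EMPTY INTERIOR at every single time, and the flow is not
irrotational at any single time.  HONEST LABEL: corollaries of Σ-5a + Z + forward vanishing + the identity theorem; nothing here proves
`stub_scalarLiouville`, `PoloidalLiouville` (1222), or bears on Navier–Stokes regularity; no summit statement is proved (crux 1222 is INCOMPARABLE with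
the summit). [folklore]
[cite: KochNadirashviliSereginSverak2009, Thm 5.2 (arXiv:0709.3599 pp. 9–10); LemarieRieusset2016, Thm. 9.12]
-/

noncomputable section

-- the summit and its single sub-problem share the name (CONVENTIONS §1)
set_option linter.dupNamespace false

open scoped Topology InnerProductSpace RealInnerProductSpace ContDiff
open Filter Set Function Metric MeasureTheory
open Literature.Analysis.FluidPDE

namespace Summit.NavierStokesRegularity.NavierStokesRegularity.Theorems.PoloidalLiouville.Antidynamo

open Summit.NavierStokesRegularity.NavierStokesRegularity.Theorems.PoloidalLiouville
  (toroidalPotential exists_norm_curl_le constantOfIrrotational)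

/-! ### ★★ Irrotational at one instant -/

/-- ★★ **IRROTATIONAL AT ONE INSTANT ⇒ IRROTATIONAL AT ALL TIMES.**  Let `v` be a bounded ancient mild solution (`ν = 1`, duality class) with
measurable slices, jointly smooth on `(−∞,0) × ℝ³` and unthreaded about `x₀`.  If `curl v(t₁, ·) ≡ 0` at one instant `t₁ < 0`, then `curl v ≡ 0`
on `(−∞,0) × ℝ³`.  [Forward: `CellFlux.forwardVanishing`.  Backward: in the analytic frame of `CellFlux.unthreadedAnalyticOrIrrotational` each
`t ↦ curl v(t, x)` is real-analytic on `(−∞,0)` and vanishes on `[t₁, 0)`, hence identically.]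
[cite: KochNadirashviliSereginSverak2009, Thm 5.2 (arXiv:0709.3599 pp. 9–10); LemarieRieusset2016, Thm. 9.12] -/
theorem curl_eq_zero_of_curl_slice_eq_zero
    (v : ℝ → EuclideanSpace ℝ (Fin 3) → EuclideanSpace ℝ (Fin 3)) (x₀ : EuclideanSpace ℝ (Fin 3))
    (hB : Literature.Analysis.FluidPDE.IsBoundedAncientMildSolution 1 v)
    (hm : ∀ t < 0, AEStronglyMeasurable (v t) volume)
    (hsm : ContDiffOn ℝ (⊤ : ℕ∞) (Function.uncurry v) (Set.Iio 0 ×ˢ Set.univ))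
    (hun : ∀ t < 0, ∀ x, ⟪x - x₀, curl (v t) x⟫ = 0)
    (h₁ : ∃ t₁ < 0, ∀ x, curl (v t₁) x = 0) :
    ∀ t < 0, ∀ x, curl (v t) x = 0 := by
  obtain ⟨t₁, ht₁, h₁⟩ := h₁
  -- forward in time
  have hfw : ∀ t, t₁ ≤ t → t < 0 → ∀ x, curl (v t) x = 0 := CellFlux.forwardVanishing v hB hm hsm t₁ ht₁ h₁
  obtain ⟨K, hK⟩ := exists_norm_curl_le hB hsm
  obtain ⟨T, -, -, hlink⟩ := toroidalPotential v x₀ K hsm hK hun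
  rcases CellFlux.unthreadedAnalyticOrIrrotational v x₀ T hB hm hsm hlink with hA | hZ
  · -- backward in time, by analytic continuation of `t ↦ curl v(t, x)`
    have hω := CellFlux.analyticOnNhd_curl_uncurry hA
    have hωt : ∀ y : EuclideanSpace ℝ (Fin 3), AnalyticOnNhd ℝ (fun t => curl (v t) y) (Iio 0) := fun y t ht =>
      (hω (t, y) ⟨ht, mem_univ _⟩).comp₂ analyticAt_id analyticAt_const
    intro t ht x
    have ht₂ : t₁ / 2 < 0 := by linarith
    have hIoo : ∀ᶠ s in 𝓝 (t₁ / 2), s ∈ Ioo t₁ 0 := Ioo_mem_nhds (by linarith) ht₂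
    have hfr : ∃ᶠ s in 𝓝[≠] (t₁ / 2), curl (v s) x = 0 :=
      ((hIoo.mono fun s hs => hfw s hs.1.le hs.2 x).filter_mono nhdsWithin_le_nhds).frequently
    exact (hωt x).eqOn_zero_of_preconnected_of_frequently_eq_zero isPreconnected_Iio ht₂ hfr ht
  · exact hZ

/-- ★★ **… HENCE SLICE-WISE CONSTANT AT ALL TIMES.** [cite: KochNadirashviliSereginSverak2009, Thm 5.2 (arXiv:0709.3599 pp. 9–10)] -/
theorem constant_of_curl_slice_eq_zero
    (v : ℝ → EuclideanSpace ℝ (Fin 3) → EuclideanSpace ℝ (Fin 3)) (x₀ : EuclideanSpace ℝ (Fin 3))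
    (hB : Literature.Analysis.FluidPDE.IsBoundedAncientMildSolution 1 v)
    (hm : ∀ t < 0, AEStronglyMeasurable (v t) volume)
    (hsm : ContDiffOn ℝ (⊤ : ℕ∞) (Function.uncurry v) (Set.Iio 0 ×ˢ Set.univ))
    (hun : ∀ t < 0, ∀ x, ⟪x - x₀, curl (v t) x⟫ = 0)
    (h₁ : ∃ t₁ < 0, ∀ x, curl (v t₁) x = 0) :
    ∀ t < 0, ∃ c : EuclideanSpace ℝ (Fin 3), ∀ x, v t x = c :=
  constantOfIrrotational v hB hsm (curl_eq_zero_of_curl_slice_eq_zero v x₀ hB hm hsm hun h₁)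

/-! ### ★★ An open zero set of the vorticity at one instant -/

/-- ★★ **AN OPEN ZERO SET OF THE VORTICITY AT ONE INSTANT ⇒ IRROTATIONAL AT ALL TIMES.**  Under the hypotheses of
`curl_eq_zero_of_curl_slice_eq_zero`, if `curl v(t₁, ·)` vanishes on a non-empty open set `U` for one `t₁ < 0`, then `curl v ≡ 0` on
`(−∞,0) × ℝ³`.  [In the analytic frame the slice `x ↦ curl v(t₁, x)` is real-analytic on the preconnected `ℝ³` and vanishes near a point of `U`,
hence identically; then the one-instant theorem.] [cite: KochNadirashviliSereginSverak2009, Thm 5.2 (arXiv:0709.3599 pp. 9–10); LemarieRieusset2016, Thm. 9.12] -/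
theorem curl_eq_zero_of_curl_eq_zero_on_open
    (v : ℝ → EuclideanSpace ℝ (Fin 3) → EuclideanSpace ℝ (Fin 3)) (x₀ : EuclideanSpace ℝ (Fin 3))
    (hB : Literature.Analysis.FluidPDE.IsBoundedAncientMildSolution 1 v)
    (hm : ∀ t < 0, AEStronglyMeasurable (v t) volume)
    (hsm : ContDiffOn ℝ (⊤ : ℕ∞) (Function.uncurry v) (Set.Iio 0 ×ˢ Set.univ))
    (hun : ∀ t < 0, ∀ x, ⟪x - x₀, curl (v t) x⟫ = 0)
    (hU : ∃ t₁ < 0, ∃ U : Set (EuclideanSpace ℝ (Fin 3)), IsOpen U ∧ U.Nonempty ∧ ∀ x ∈ U, curl (v t₁) x = 0) :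
    ∀ t < 0, ∀ x, curl (v t) x = 0 := by
  obtain ⟨t₁, ht₁, U, hUo, ⟨x₁, hx₁⟩, hU⟩ := hU
  obtain ⟨K, hK⟩ := exists_norm_curl_le hB hsm
  obtain ⟨T, -, -, hlink⟩ := toroidalPotential v x₀ K hsm hK hun
  rcases CellFlux.unthreadedAnalyticOrIrrotational v x₀ T hB hm hsm hlink with hA | hZ
  · -- the slice at `t₁` is analytic on `ℝ³` and vanishes near `x₁`, hence everywhere
    have hω := CellFlux.analyticOnNhd_curl_uncurry hA
    have hωx : AnalyticOnNhd ℝ (fun y : EuclideanSpace ℝ (Fin 3) => curl (v t₁) y) univ := fun y _ =>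
      (hω (t₁, y) ⟨ht₁, mem_univ _⟩).comp₂ analyticAt_const analyticAt_id
    have hUn : U ∈ 𝓝 x₁ := hUo.mem_nhds hx₁
    have hev : (fun y : EuclideanSpace ℝ (Fin 3) => curl (v t₁) y) =ᶠ[𝓝 x₁] 0 :=
      Filter.eventually_of_mem hUn fun y hy => hU y hy
    have hslice : ∀ x, curl (v t₁) x = 0 := fun x =>
      hωx.eqOn_zero_of_preconnected_of_eventuallyEq_zero isPreconnected_univ (mem_univ x₁) hev (mem_univ x)
    exact curl_eq_zero_of_curl_slice_eq_zero v x₀ hB hm hsm hun ⟨t₁, ht₁, hslice⟩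
  · exact hZ

/-- ★★ **… HENCE SLICE-WISE CONSTANT AT ALL TIMES.** [cite: KochNadirashviliSereginSverak2009, Thm 5.2 (arXiv:0709.3599 pp. 9–10)] -/
theorem constant_of_curl_eq_zero_on_open
    (v : ℝ → EuclideanSpace ℝ (Fin 3) → EuclideanSpace ℝ (Fin 3)) (x₀ : EuclideanSpace ℝ (Fin 3))
    (hB : Literature.Analysis.FluidPDE.IsBoundedAncientMildSolution 1 v)
    (hm : ∀ t < 0, AEStronglyMeasurable (v t) volume)
    (hsm : ContDiffOn ℝ (⊤ : ℕ∞) (Function.uncurry v) (Set.Iio 0 ×ˢ Set.univ))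
    (hun : ∀ t < 0, ∀ x, ⟪x - x₀, curl (v t) x⟫ = 0)
    (hU : ∃ t₁ < 0, ∃ U : Set (EuclideanSpace ℝ (Fin 3)), IsOpen U ∧ U.Nonempty ∧ ∀ x ∈ U, curl (v t₁) x = 0) :
    ∀ t < 0, ∃ c : EuclideanSpace ℝ (Fin 3), ∀ x, v t x = c :=
  constantOfIrrotational v hB hsm (curl_eq_zero_of_curl_eq_zero_on_open v x₀ hB hm hsm hun hU)

/-- **DICHOTOMY FOR LEVEL-SET ARGUMENTS: IRROTATIONAL, OR THE VORTICITY IS NON-ZERO ON A DENSE SET AT EVERY TIME.**  Under the hypotheses of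
`curl_eq_zero_of_curl_slice_eq_zero`: either `curl v ≡ 0` on `(−∞,0) × ℝ³`, or for every `t < 0` the set `{x | curl v(t, x) ≠ 0}` is dense in
`ℝ³` (the critical set `{curl v(t, ·) = 0}` has empty interior at every single time). [folklore] -/
theorem dense_curl_ne_zero_or_curl_eq_zero
    (v : ℝ → EuclideanSpace ℝ (Fin 3) → EuclideanSpace ℝ (Fin 3)) (x₀ : EuclideanSpace ℝ (Fin 3))
    (hB : Literature.Analysis.FluidPDE.IsBoundedAncientMildSolution 1 v)
    (hm : ∀ t < 0, AEStronglyMeasurable (v t) volume)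
    (hsm : ContDiffOn ℝ (⊤ : ℕ∞) (Function.uncurry v) (Set.Iio 0 ×ˢ Set.univ))
    (hun : ∀ t < 0, ∀ x, ⟪x - x₀, curl (v t) x⟫ = 0) :
    (∀ t < 0, ∀ x, curl (v t) x = 0) ∨ ∀ t < 0, Dense {x : EuclideanSpace ℝ (Fin 3) | curl (v t) x ≠ 0} := by
  by_cases h : ∀ t < 0, Dense {x : EuclideanSpace ℝ (Fin 3) | curl (v t) x ≠ 0}
  · exact Or.inr h
  · left
    push Not at h
    obtain ⟨t₁, ht₁, hnd⟩ := h
    -- a non-dense set misses a non-empty open set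
    rw [dense_iff_inter_open] at hnd
    push Not at hnd
    obtain ⟨U, hUo, hUne, hUint⟩ := hnd
    refine curl_eq_zero_of_curl_eq_zero_on_open v x₀ hB hm hsm hun ⟨t₁, ht₁, U, hUo, hUne, fun x hx => ?_⟩
    by_contra hne
    have hxin : x ∈ U ∩ {x : EuclideanSpace ℝ (Fin 3) | curl (v t₁) x ≠ 0} := ⟨hx, hne⟩
    rw [hUint] at hxin
    exact hxin

/-! ### The wall's letters -/

/-- ★★ **THE WALL'S LETTER: TRIVIAL AT ONE INSTANT ⇒ TRIVIAL.**  If the vorticity of the wall's flow is `∇T(t,·) × (· − x₀)` and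
`∇T(t₁, ·) × (· − x₀) ≡ 0` for one `t₁ < 0`, then `∇T × (x − x₀) ≡ 0` on `(−∞,0) × ℝ³`.
[cite: KochNadirashviliSereginSverak2009, Thm 5.2 (arXiv:0709.3599 pp. 9–10)] -/
theorem stubScalarLiouville_of_slice_eq_zero
    (v : ℝ → EuclideanSpace ℝ (Fin 3) → EuclideanSpace ℝ (Fin 3)) (x₀ : EuclideanSpace ℝ (Fin 3))
    (T : ℝ → EuclideanSpace ℝ (Fin 3) → ℝ)
    (hB : Literature.Analysis.FluidPDE.IsBoundedAncientMildSolution 1 v)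
    (hm : ∀ t < 0, AEStronglyMeasurable (v t) volume)
    (hsm : ContDiffOn ℝ (⊤ : ℕ∞) (Function.uncurry v) (Set.Iio 0 ×ˢ Set.univ))
    (hrep : ∀ t < 0, ∀ x, Literature.Analysis.FluidPDE.curl (v t) x =
      Literature.Analysis.FluidPDE.cross (gradient (T t) x) (x - x₀))
    (h₁ : ∃ t₁ < 0, ∀ x, Literature.Analysis.FluidPDE.cross (gradient (T t₁) x) (x - x₀) = 0) :
    ∀ t < 0, ∀ x, Literature.Analysis.FluidPDE.cross (gradient (T t) x) (x - x₀) = 0 := by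
  have hun : ∀ t < 0, ∀ x, ⟪x - x₀, curl (v t) x⟫ = 0 := fun t ht x => by
    rw [hrep t ht x]
    simp [cross, crossProduct, PiLp.inner_apply, Fin.sum_univ_three]
    ring
  obtain ⟨t₁, ht₁, h₁⟩ := h₁
  have h₁' : ∀ x, curl (v t₁) x = 0 := fun x => by rw [hrep t₁ ht₁ x]; exact h₁ x
  intro t ht x
  rw [← hrep t ht x]
  exact curl_eq_zero_of_curl_slice_eq_zero v x₀ hB hm hsm hun ⟨t₁, ht₁, h₁'⟩ t ht x

/-- ★★ **THE WALL'S LETTER: TRIVIAL ON AN OPEN SET AT ONE INSTANT ⇒ TRIVIAL.**  If the vorticity of the wall's flow is `∇T(t,·) × (· − x₀)` and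
`∇T(t₁, ·) × (· − x₀)` vanishes on a non-empty open set for one `t₁ < 0`, then `∇T × (x − x₀) ≡ 0` on `(−∞,0) × ℝ³`.
[cite: KochNadirashviliSereginSverak2009, Thm 5.2 (arXiv:0709.3599 pp. 9–10)] -/
theorem stubScalarLiouville_of_eq_zero_on_open
    (v : ℝ → EuclideanSpace ℝ (Fin 3) → EuclideanSpace ℝ (Fin 3)) (x₀ : EuclideanSpace ℝ (Fin 3))
    (T : ℝ → EuclideanSpace ℝ (Fin 3) → ℝ)
    (hB : Literature.Analysis.FluidPDE.IsBoundedAncientMildSolution 1 v)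
    (hm : ∀ t < 0, AEStronglyMeasurable (v t) volume)
    (hsm : ContDiffOn ℝ (⊤ : ℕ∞) (Function.uncurry v) (Set.Iio 0 ×ˢ Set.univ))
    (hrep : ∀ t < 0, ∀ x, Literature.Analysis.FluidPDE.curl (v t) x =
      Literature.Analysis.FluidPDE.cross (gradient (T t) x) (x - x₀))
    (hU : ∃ t₁ < 0, ∃ U : Set (EuclideanSpace ℝ (Fin 3)), IsOpen U ∧ U.Nonempty ∧
      ∀ x ∈ U, Literature.Analysis.FluidPDE.cross (gradient (T t₁) x) (x - x₀) = 0) :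
    ∀ t < 0, ∀ x, Literature.Analysis.FluidPDE.cross (gradient (T t) x) (x - x₀) = 0 := by
  have hun : ∀ t < 0, ∀ x, ⟪x - x₀, curl (v t) x⟫ = 0 := fun t ht x => by
    rw [hrep t ht x]
    simp [cross, crossProduct, PiLp.inner_apply, Fin.sum_univ_three]
    ring
  obtain ⟨t₁, ht₁, U, hUo, hUne, hU⟩ := hU
  have hU' : ∀ x ∈ U, curl (v t₁) x = 0 := fun x hx => by rw [hrep t₁ ht₁ x]; exact hU x hx
  intro t ht x
  rw [← hrep t ht x]
  exact curl_eq_zero_of_curl_eq_zero_on_open v x₀ hB hm hsm hun ⟨t₁, ht₁, U, hUo, hUne, hU'⟩ t ht x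

end Summit.NavierStokesRegularity.NavierStokesRegularity.Theorems.PoloidalLiouville.Antidynamo

end
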